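import Literature.Computability.QuantumComplexity.MSubspaceSignReadoutMachine
import Literature.Computability.QuantumComplexity.QuadraticFourierSamplerProofs
import Literature.Computability.QuantumComplexity.CubicForrelationEstimatorAnalysis
import Literature.Computability.Complexity.F2RowReductionRank
import HarnessLib

/-!
# The M-subspace sign readout, III: the dual-pair sampler is exact

Proof-only analysis of the sampler of `MSubspaceSignReadoutMachine.lean` (`MMReadout.x0Of`, `kers`, `xOf`,
`dotL`, `rbit`). Fix `n`, a list of bit rows `L` with reduced form `S = rrun n L`, the linear subspace
`V = spanV n L = {v | v ∈ rowSpan L}` of `{0,1}ⁿ` and a Boolean function `g` AFFINE ON EVERY COSET of `V`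
(all second differences of `g` along `V` vanish), handed to the machine as a circuit code `cg` with
`evalP cg v = g (toInput n v)`. Say `x` MATCHES `z` when the character `v ↦ (-1)^{x·v}` of `V` is the
linear part `v ↦ (-1)^{g(z⊕v)+g(z)}` of `g` on `z ⊕ V` (`matchSet`). Then:

* `bz_x0V`: the machine's `x₀(z)` is the dual vector of the linear part (`F2RowReductionRank`), hence
  matches `z`, and the matching `x` are exactly the coset `x₀(z) ⊕ V^⊥` (`mem_matchSet_iff`);
* `bz_kcV`: the coin combination `w ↦ ⊕_{f : w_f} kvec f` is the kernel parametrisation, so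
  (`card_fiber_xV`) for every `z` the sampled partner `x(z,w)` hits each matching `x` for exactly
  `2^{#pivs}` coin vectors `w` and no other `x`;
* `sum_sampler_eq`: consequently `Σ_{z,w} F(z, x(z,w)) = 2^{#pivs} · Σ_z Σ_{x matching z} F(z,x)` for every
  `F` — the sampler is the uniform distribution on the matching pairs, with constant multiplicity;
* `signOf_rbit`: the recorded bit of a round has sign `(-1)^{f(x)} (-1)^{g(z)} (-1)^{x·z}`.

With the dual-value identity `Σ_z Σ_{x matching z} (-1)^{f x + g z + x·z} = √(2^{3n}) Φ(f,g)` (Poisson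
summation over the cosets of `V`; an input of the sequel) and rank `n/2`, the mean of a round is EXACTLY
`Φ(f,g)` (`MSubspaceSignReadoutRounds.lean`).

## References

* C. Carlet, *Boolean Functions for Cryptography and Coding Theory*, CUP 2020, Prop. 54, §6.1.5 (Maiorana–
  McFarland functions, their duals and Walsh supports). [Carlet2020]
* D. E. Knuth, TAOCP Vol. 2, §4.6.2 Algorithm N. [KnuthTAOCP2]
* S. Aaronson, A. Ambainis, *Forrelation*, SIAM J. Comput. 47 (2018), §1.1.1. [AaronsonAmbainis2018]
-/

noncomputable section

namespace Literature.Computability.QuantumComplexity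

namespace MMReadout

open Finset Literature.Computability.Complexity Literature.Computability.Complexity.F2Elim
open Literature.Computability.Complexity.LowDegree (xorVec xorVec_apply)
open Literature.Computability.Complexity.BLR (toZ toZ_xor toZ_injective)
open BuzetChailloux (bxor zeroVec)
open ForrCode QuadSampler CubicDequant

variable {n : ℕ}

/-! ### Bridges between bit vectors and `𝔽₂`-vectors -/

/-- `bxor` is `xorVec`. [folklore] -/
theorem bxor_eq_xorVec (x y : Fin n → Bool) : bxor x y = xorVec x y := rfl

/-- `zeroVec` is `zeroV`. [folklore] -/
theorem zeroVec_eq_zeroV : (zeroVec : Fin n → Bool) = zeroV := rfl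

/-- `zb 0 = 0ⁿ`. [folklore] -/
@[simp] theorem zb_zero : zb (0 : Fin n → ZMod 2) = zeroV := by
  apply bz_injective; rw [bz_zb, bz_zeroV]

/-- `zb` is additive. [folklore] -/
theorem zb_add (t t' : Fin n → ZMod 2) : zb (t + t') = xorVec (zb t) (zb t') := by
  apply bz_injective; rw [bz_zb, bz_xorVec, bz_zb, bz_zb]

/-- `x ⊕ 0ⁿ = x`. [folklore] -/
@[simp] theorem xorVec_zeroV (x : Fin n → Bool) : xorVec x zeroV = x := by
  funext i; simp [zeroV]

/-- The bit vector of a vector is the `if`-reading used in route statements. [folklore] -/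
theorem bz_eq_ite (v : Fin n → Bool) : bz v = fun i => if v i then (1 : ZMod 2) else 0 := rfl

/-- `sgnZ` is injective. [folklore] -/
theorem sgnZ_injective : Function.Injective sgnZ := by
  intro a b h
  rcases zmod2_eq_zero_or_one a with rfl | rfl <;> rcases zmod2_eq_zero_or_one b with rfl | rfl
  · rfl
  · exact absurd h (by rw [sgnZ_zero, sgnZ_of_ne_zero one_ne_zero]; norm_num)
  · exact absurd h (by rw [sgnZ_zero, sgnZ_of_ne_zero one_ne_zero]; norm_num)
  · rfl

/-- Matching in signs is matching in `𝔽₂`: `(-1)^{x·v} = (-1)^{a} (-1)^{b} ↔ x·v = a + b`. [folklore] -/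
theorem twist_eq_signOf_mul_iff (x v : Fin n → Bool) (a b : Bool) :
    twist x v = signOf a * signOf b ↔ dotZ (bz x) (bz v) = toZ a + toZ b := by
  rw [twist_eq_sgnZ, signOf_eq_sgnZ, signOf_eq_sgnZ, ← sgnZ_add]
  exact ⟨fun h => sgnZ_injective h, fun h => by rw [h]⟩

/-! ### The subspace of a certificate and the matching sets -/

open scoped Classical in
/-- The linear subspace `V_L = {v ∈ {0,1}ⁿ | v ∈ rowSpan L}` of a list of bit rows. [cite: Carlet2020, Prop. 54] -/
def spanV (n : ℕ) (L : List (List Bool)) : Finset (Fin n → Bool) := univ.filter fun v => bz v ∈ rowSpan n L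

/-- Membership in `spanV`, in the `if`-reading of route statements. [folklore] -/
theorem mem_spanV_iff {L : List (List Bool)} (v : Fin n → Bool) :
    v ∈ spanV n L ↔ (fun i => if v i then (1 : ZMod 2) else 0) ∈ rowSpan n L := by
  rw [← bz_eq_ite]; simp [spanV]

/-- Membership in `spanV` through `bz`. [folklore] -/
theorem mem_spanV {L : List (List Bool)} (v : Fin n → Bool) : v ∈ spanV n L ↔ bz v ∈ rowSpan n L := by
  simp [spanV]

/-- `a + b = c ↔ b = c + a` for vectors over `𝔽₂`. [folklore] -/
theorem add_eq_iff_eq_add (a b c : Fin n → ZMod 2) : a + b = c ↔ b = c + a := by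
  constructor
  · rintro rfl; funext i; simp only [Pi.add_apply]; rw [add_comm (a i), add_assoc, CharTwo.add_self_eq_zero, add_zero]
  · rintro rfl; funext i; simp only [Pi.add_apply]; rw [add_comm (c i), ← add_assoc, CharTwo.add_self_eq_zero, zero_add]

/-- `0 ∈ V_L`. [folklore] -/
theorem zeroVec_mem_spanV (L : List (List Bool)) : (zeroVec : Fin n → Bool) ∈ spanV n L := by
  rw [mem_spanV, zeroVec_eq_zeroV, bz_zeroV]; exact Submodule.zero_mem _

/-- `V_L` is closed under `⊕`. [folklore] -/
theorem bxor_mem_spanV {L : List (List Bool)} {x y : Fin n → Bool} (hx : x ∈ spanV n L) (hy : y ∈ spanV n L) :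
    bxor x y ∈ spanV n L := by
  rw [mem_spanV] at hx hy ⊢
  rw [bxor_eq_xorVec, bz_xorVec]; exact Submodule.add_mem _ hx hy

/-- The rows lie in `V_L`. [folklore] -/
theorem toInput_mem_spanV {L : List (List Bool)} {r : List Bool} (hr : r ∈ L) : toInput n r ∈ spanV n L := by
  rw [mem_spanV, ← vecZ_eq_bz]; exact vecZ_mem_rowSpan hr

/-- `zb t ∈ V_L` for `t` in the row span. [folklore] -/
theorem zb_mem_spanV {L : List (List Bool)} {t : Fin n → ZMod 2} (ht : t ∈ rowSpan n L) : zb t ∈ spanV n L := by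
  rw [mem_spanV, bz_zb]; exact ht

/-- The `x` MATCHING `z`: the character `v ↦ (-1)^{x·v}` of `V` is the linear part `v ↦ (-1)^{g(z⊕v)+g(z)}`
of `g` on `z ⊕ V`. [cite: Carlet2020, §6.1.5] -/
def matchSet (g : (Fin n → Bool) → Bool) (V : Finset (Fin n → Bool)) (z : Fin n → Bool) : Finset (Fin n → Bool) :=
  univ.filter fun x => ∀ v ∈ V, twist x v = signOf (g (bxor z v)) * signOf (g z)

/-- The linear part of `g` on the coset of `z`, as a function on `𝔽₂ⁿ`: `φ_z(t) = g(z ⊕ t) + g(z)`.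
[cite: Carlet2020, §6.1.5] -/
def linPart (g : (Fin n → Bool) → Bool) (z : Fin n → Bool) (t : Fin n → ZMod 2) : ZMod 2 :=
  toZ (g (xorVec z (zb t))) + toZ (g z)

/-- `φ_z(0) = 0`. [folklore] -/
theorem linPart_zero (g : (Fin n → Bool) → Bool) (z : Fin n → Bool) : linPart g z 0 = 0 := by
  rw [linPart, zb_zero, xorVec_zeroV, CharTwo.add_self_eq_zero]

section Affine

variable {L : List (List Bool)} {g : (Fin n → Bool) → Bool}
  (hM : ∀ u ∈ spanV n L, ∀ v ∈ spanV n L, ∀ y,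
    (g y ^^ g (bxor y u) ^^ g (bxor y v) ^^ g (bxor y (bxor u v))) = false)
include hM

/-- **Affine on cosets ⇒ the linear part is additive on the row span.** [cite: Carlet2020, Prop. 54] -/
theorem linPart_add (z : Fin n → Bool) {t t' : Fin n → ZMod 2} (ht : t ∈ rowSpan n L) (ht' : t' ∈ rowSpan n L) :
    linPart g z (t + t') = linPart g z t + linPart g z t' := by
  have h := hM (zb t) (zb_mem_spanV ht) (zb t') (zb_mem_spanV ht') z
  simp only [linPart, zb_add, bxor_eq_xorVec] at h ⊢
  have h' := congrArg toZ h
  rw [toZ_xor, toZ_xor, toZ_xor, show toZ false = 0 from rfl] at h'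
  -- `a + b + c + d = 0` in characteristic two
  have e : toZ (g (xorVec z (xorVec (zb t) (zb t')))) = toZ (g z) + toZ (g (xorVec z (zb t))) + toZ (g (xorVec z (zb t'))) := by
    have := (CharTwo.add_eq_zero (R := ZMod 2)).1 h'
    rw [this]
  rw [e]; ring

omit hM in
/-- Matching `z` is representing the linear part on the whole row span. [cite: Carlet2020, §6.1.5] -/
theorem mem_matchSet_iff_forall (z x : Fin n → Bool) :
    x ∈ matchSet g (spanV n L) z ↔ ∀ t ∈ rowSpan n L, dotZ (bz x) t = linPart g z t := by
  rw [matchSet, mem_filter]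
  simp only [mem_univ, true_and]
  constructor
  · intro h t ht
    have := (twist_eq_signOf_mul_iff x (zb t) _ _).1 (h (zb t) (zb_mem_spanV ht))
    rwa [bz_zb] at this
  · intro h v hv
    rw [twist_eq_signOf_mul_iff, h (bz v) ((mem_spanV v).1 hv), linPart, zb_bz, bxor_eq_xorVec]

end Affine

/-! ### Reading the machine's vectors -/

section Readings

variable (cg : PCirc) (g : (Fin n → Bool) → Bool) (hg : ∀ v, evalP cg v = g (toInput n v))

/-- The dual vector `x₀(z)` of the machine, as a bit vector. [folklore] -/
def x0V (n : ℕ) (cg : PCirc) (S : List Row) (z : Fin n → Bool) : Fin n → Bool := toInput n (x0Of n cg S (List.ofFn z))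

/-- The coin combination `⊕_{f : w_f} kvec f`, as a bit vector. [folklore] -/
def kcV (n : ℕ) (S : List Row) (w : Fin n → Bool) : Fin n → Bool := toInput n (xorSel n (kers n S) (List.ofFn w))

/-- The sampled partner `x(z, w)`, as a bit vector. [folklore] -/
def xV (n : ℕ) (cg : PCirc) (S : List Row) (z w : Fin n → Bool) : Fin n → Bool :=
  toInput n (xOf n cg S (List.ofFn z) (List.ofFn w))

omit hg in
/-- `x(z,w) = x₀(z) ⊕ kc(w)`. [folklore] -/
theorem xV_eq (S : List Row) (z w : Fin n → Bool) : xV n cg S z w = xorVec (x0V n cg S z) (kcV n S w) := by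
  rw [xV, xOf, toInput_bxorL]; rfl

include hg in
/-- **The machine's `x₀(z)` is the dual vector of the linear part** `φ_z` (read off the reduced form).
[cite: Carlet2020, §6.1.5] -/
theorem bz_x0V (S : List Row) (z : Fin n → Bool) :
    bz (x0V n cg S z) = fun c : Fin n => if isPiv S c = true then linPart g z (vecZ n (prow S c)) else 0 := by
  funext c
  rw [x0V, x0Of, toInput_map_range, bz_apply]
  by_cases hp : isPiv S c = true
  · rw [hp, Bool.true_and, if_pos rfl, toZ_xor, hg, hg, toInput_bxorL, toInput_ofFn, linPart, vecZ_eq_bz, zb_bz]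
  · rw [Bool.not_eq_true] at hp
    rw [hp, Bool.false_and, if_neg Bool.false_ne_true]; rfl

omit hg in
/-- **The coin combination is the kernel parametrisation** `w ↦ Σ_{f free} [w_f] · kvec f`.
[cite: KnuthTAOCP2, §4.6.2 Algorithm N] -/
theorem bz_kcV (S : List Row) (w : Fin n → Bool) :
    bz (kcV n S w) = ∑ f ∈ frees n S, toZ (w f) • vecZ n (kvec n S f) := by
  rw [kcV, ← vecZ_eq_bz, xorSel, vecZ_foldl_bxorL, kers, zipWith_map_range_ofFn, List.map_ofFn, List.sum_ofFn,
    show vecZ n (zeroL n) = 0 from by rw [vecZ_eq_bz, toInput_zeroL, bz_zeroV], zero_add, frees, sum_filter]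
  refine sum_congr rfl fun f _ => ?_
  simp only [Function.comp_apply]
  cases isPiv S f
  · cases w f
    · simp [Literature.Computability.Complexity.BLR.toZ]
    · simp [Literature.Computability.Complexity.BLR.toZ]
  · cases w f <;> simp

end Readings

/-! ### The fibres of the sampler -/

section Fibres

variable {L : List (List Bool)} {g : (Fin n → Bool) → Bool} {cg : PCirc}
  (hg : ∀ v, evalP cg v = g (toInput n v))
  (hM : ∀ u ∈ spanV n L, ∀ v ∈ spanV n L, ∀ y,
    (g y ^^ g (bxor y u) ^^ g (bxor y v) ^^ g (bxor y (bxor u v))) = false)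
include hg hM

/-- **Matching `z` ⟺ lying in the coset `x₀(z) ⊕ V^⊥`.** [cite: Carlet2020, §6.1.5] -/
theorem mem_matchSet_iff (z x : Fin n → Bool) :
    x ∈ matchSet g (spanV n L) z ↔ bz x + bz (x0V n cg (rrun n L) z) ∈ kerSet n L := by
  rw [mem_matchSet_iff_forall, bz_x0V cg g hg,
    forall_dotZ_eq_iff_add_mem_kerSet (linPart g z) (linPart_zero g z) (fun u hu v hv => linPart_add hM z hu hv)]

/-- **The fibres of the sampler**: for every `z`, the partner `x(z,w)` equals a matching `x` for exactly
`2^{#pivs}` coin vectors `w`, and a non-matching `x` for none. [cite: KnuthTAOCP2, §4.6.2 Algorithm N] -/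
theorem card_fiber_xV (z x : Fin n → Bool) :
    (univ.filter fun w : Fin n → Bool => xV n cg (rrun n L) z w = x).card =
      if x ∈ matchSet g (spanV n L) z then 2 ^ (pivs n (rrun n L)).card else 0 := by
  classical
  set S := rrun n L with hS
  have hfib : (univ.filter fun w : Fin n → Bool => xV n cg S z w = x) =
      univ.filter fun w : Fin n → Bool =>
        ∑ f ∈ frees n S, toZ (w f) • vecZ n (kvec n S f) = bz x + bz (x0V n cg S z) := by
    ext w
    simp only [mem_filter, mem_univ, true_and]
    rw [← bz_kcV, xV_eq, ← bz_injective.eq_iff, bz_xorVec, add_eq_iff_eq_add]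
  rw [hfib]
  by_cases hx : x ∈ matchSet g (spanV n L) z
  · rw [if_pos hx]
    exact card_filter_sum_smul_kvec_eq ((mem_matchSet_iff hg hM z x).1 hx)
  · rw [if_neg hx, card_eq_zero, filter_eq_empty_iff]
    intro w _ hw
    exact hx ((mem_matchSet_iff hg hM z x).2 (hw ▸ sum_smul_kvec_mem_kerSet _))

/-- **The sampler is uniform on the matching pairs, with constant multiplicity `2^{#pivs}`**: for every
weight `F`, `Σ_{z,w} F(z, x(z,w)) = 2^{#pivs} Σ_z Σ_{x matching z} F(z,x)`. [cite: Carlet2020, §6.1.5] -/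
theorem sum_sampler_eq (F : (Fin n → Bool) → (Fin n → Bool) → ℝ) :
    ∑ z : Fin n → Bool, ∑ w : Fin n → Bool, F z (xV n cg (rrun n L) z w) =
      (2 : ℝ) ^ (pivs n (rrun n L)).card * ∑ z : Fin n → Bool, ∑ x ∈ matchSet g (spanV n L) z, F z x := by
  classical
  rw [mul_sum]
  refine sum_congr rfl fun z _ => ?_
  have step : ∀ w : Fin n → Bool, F z (xV n cg (rrun n L) z w) =
      ∑ x : Fin n → Bool, if xV n cg (rrun n L) z w = x then F z x else 0 := fun w => by
    rw [sum_ite_eq univ (xV n cg (rrun n L) z w) (F z), if_pos (mem_univ _)]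
  rw [sum_congr rfl fun w _ => step w, sum_comm]
  have inner : ∀ x : Fin n → Bool, (∑ w : Fin n → Bool, if xV n cg (rrun n L) z w = x then F z x else 0) =
      ((univ.filter fun w : Fin n → Bool => xV n cg (rrun n L) z w = x).card : ℝ) * F z x := fun x => by
    rw [← sum_filter, sum_const, nsmul_eq_mul]
  rw [sum_congr rfl fun x _ => inner x]
  simp_rw [card_fiber_xV hg hM z]
  rw [mul_sum, ← sum_filter_add_sum_filter_not univ (fun x => x ∈ matchSet g (spanV n L) z)]
  have h1 : ∑ x ∈ univ.filter (fun x => x ∈ matchSet g (spanV n L) z),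
      ((if x ∈ matchSet g (spanV n L) z then 2 ^ (pivs n (rrun n L)).card else 0 : ℕ) : ℝ) * F z x =
      ∑ x ∈ matchSet g (spanV n L) z, (2 : ℝ) ^ (pivs n (rrun n L)).card * F z x := by
    rw [show univ.filter (fun x => x ∈ matchSet g (spanV n L) z) = matchSet g (spanV n L) z from by ext; simp]
    exact sum_congr rfl fun x hx => by rw [if_pos hx]; push_cast; ring
  have h2 : ∑ x ∈ univ.filter (fun x => ¬ x ∈ matchSet g (spanV n L) z),
      ((if x ∈ matchSet g (spanV n L) z then 2 ^ (pivs n (rrun n L)).card else 0 : ℕ) : ℝ) * F z x = 0 :=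
    sum_eq_zero fun x hx => by rw [if_neg (mem_filter.1 hx).2]; simp
  rw [h1, h2, add_zero]

end Fibres

/-! ### The recorded bit of a round -/

/-- `toZ` of a xor-fold is the sum. [folklore] -/
theorem toZ_foldl_xor (l : List Bool) (b : Bool) : toZ (l.foldl (fun a c => (a ^^ c)) b) = toZ b + (l.map toZ).sum := by
  induction l generalizing b with
  | nil => simp
  | cons a l ih => rw [List.foldl_cons, ih, toZ_xor, List.map_cons, List.sum_cons, add_assoc]

/-- **The machine's dot product is the dot product**: `[dotL n u v] = (u · v)` in `𝔽₂`. [folklore] -/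
theorem toZ_dotL (u v : List Bool) : toZ (dotL n u v) = dotZ (vecZ n u) (vecZ n v) := by
  rw [dotL, toZ_foldl_xor, show toZ false = 0 from rfl, zero_add, List.map_map, list_sum_map_range_eq, dotZ]
  refine sum_congr rfl fun i _ => ?_
  simp only [Function.comp_apply, vecZ]
  exact Literature.Computability.Complexity.BLR.toZ_and _ _

/-- **The sign of the recorded bit** of a round is `(-1)^{f(x)} (-1)^{g(z)} (-1)^{x·z}` for the sampled
pair `(z, x(z,w))`. [cite: AaronsonAmbainis2018, §1.1.1] -/
theorem signOf_rbit {cf cg : PCirc} {f g : (Fin n → Bool) → Bool} (hf : ∀ v, evalP cf v = f (toInput n v))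
    (hg : ∀ v, evalP cg v = g (toInput n v)) (S : List Row) (z w : Fin n → Bool) :
    signOf (rbit n cf cg S (List.ofFn z) (List.ofFn w)) =
      signOf (f (xV n cg S z w)) * signOf (g z) * twist (xV n cg S z w) z := by
  rw [rbit, signOf_xor, signOf_xor, hf, hg, toInput_ofFn, twist_eq_sgnZ, signOf_eq_sgnZ (dotL _ _ _), toZ_dotL,
    vecZ_eq_bz, vecZ_eq_bz, toInput_ofFn]
  rfl

end MMReadout

end Literature.Computability.QuantumComplexity

end
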